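import Mathlib
import Summits.Langlands.Langlands.Theorems.QuadraticWindowHostInducedRepSignedTwistAux
import Summits.Langlands.Langlands.Theorems.QuadraticWindowHostInducedRepInducedPackageAux
import Literature.NumberTheory.Automorphic.AutomorphicTwistHecke
import Literature.NumberTheory.Automorphic.StrongMultiplicityOneSphericalProofs
import Literature.NumberTheory.Automorphic.AshSmithTheoryHeckeLevelProofs
import Literature.NumberTheory.Automorphic.AutomorphicFormsGLContinuous
import Literature.NumberTheory.GaloisRepresentations.HeckeLFunctionNonvanishingLineProofs

/-!
# Stub `stub_package` of line `one-transparent-pane` (crux `QuadraticWindow.HostInducedRep`,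
# stmt-Langlands-10902): helper file 3 — the Satake → host-polynomial dictionary of a member

LOG (worker `stub_package`, 2026-08-16; full log in helper 1 `…HostInducedRepPackage.lean`). FACT-FREE.
Setting: `F/F₀`, `K/F₀` quadratic; `Π` on `GL_{2n}/F₀` with Satake parameter `B` at `v` inducing the
twisted family `(α_w c_w)_{w∣v}` (`IsInducedPackage` relation); `Π_K` a PLACEWISE base change of `Π`
(`Sat(Π_K,u) = Sat(Π,v)^{f(u∣v)}` over `v` unramified in `K`); `τ'` the twist of `Π_K` by an arbitrary
Hecke character `ψ₀` (`τ'.W = (ψ₀∘det)·Π_K.W`); `ψ₁ = ψ₀‖·‖^{-n/2}`.  Main statement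
(`member_dictionary(_split)`): at `u ∣ v` with `v` unramified in `K` and `ψ₀` unramified at `u`, `ψ₁`
is unramified at `u` and `τ'` has a Satake parameter `β` at `u` with
`arithFrobPolyOfSatake ι q_u (2n) (β·ψ₁(ϖ_u)⁻¹) = ∏_{x root of hostPoly v} (X - x^{f(u∣v)})` (`= hostPoly v`
if `f = 1`) — verbatim the dictionary clauses of the reshaped `stub_package`/`stub_patch`/
`stub_galoisOverK`.  §2 polynomial identities (`(√q)^{2n-1}q^{-n/2} = (√q)^{n-1}`, powers polynomial,
`dictionary_powers/_split`); §3 the twist by an ARBITRARY Hecke character at every place where it is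
unramified (`heckeCharacter_exists_level_not_dvd`: a level of `χ∘det` prime to `u`, from
`HeckeCharacter.exists_level` through the open finite part `K_f(𝔪₀)`;
`hasSatakeParamAt_twist_hecke_placewise`); §3b norm shifts at uniformizers; §3c the member dictionary.
Refs: Arthur–Clozel, AMS 120, Ch. 3, proof of Thm. 3.1, Def. 6.1 [ArthurClozelAMS120]; Borel–Jacquet
1979 §4.6 [BorelJacquet1979]; Tate, Thesis, Lemma 3.2.1, §4.3 [TateThesis1967].
-/

open scoped BigOperators Polynomial Classical
open Polynomial IsDedekindDomain NumberField
open Literature.NumberTheory.Automorphic Literature.NumberTheory.GaloisRepresentations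
open Summit.Langlands.Langlands.Theorems.HostInducedRep.GrsExplicitDescent

-- `Summit.Langlands.Langlands.…` (summit = sub-problem name, D-0017 layout) trips `dupNamespace`.
set_option linter.dupNamespace false

noncomputable section

namespace Summit.Langlands.Langlands.Theorems.HostInducedRep.OneTransparentPane
/-! ## §2 The Satake → host-polynomial dictionary (rank `2n` over `K` versus rank `n` over `F`) -/

section Dictionary

variable {ℓ : ℕ} [Fact ℓ.Prime]

/-- `2n - 1 = n + (n - 1)` in `ℕ` (also for `n = 0`). [folklore] -/
private theorem two_mul_sub_one (n : ℕ) : 2 * n - 1 = n + (n - 1) := by omega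

/-- **Untwisting by `‖·‖^{-n/2}` at residue degree one**: dividing a rank-`2n` parameter by `(√q)^n`
converts the rank-`2n` normalisation into the rank-`n` one, `(√q)^{2n-1}(√q)^{-n} = (√q)^{n-1}`. [folklore] -/
theorem arithFrobPolyOfSatake_map_mul_inv_sqrt_pow (ι : PadicAlgCl ℓ ≃+* ℂ) {q : ℕ} (hq : 0 < q)
    (n : ℕ) (B : Multiset ℂ) :
    arithFrobPolyOfSatake ι q (2 * n) (B.map (· * ((((Real.sqrt q : ℝ) : ℂ)) ^ n)⁻¹)) =
      arithFrobPolyOfSatake ι q n B := by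
  unfold arithFrobPolyOfSatake
  rw [Multiset.map_map]
  refine congrArg Multiset.prod (Multiset.map_congr rfl fun b _ ↦ ?_)
  simp only [Function.comp_apply]
  congr 3
  have hr := sqrt_cast_ne_zero hq
  rw [two_mul_sub_one, pow_add]
  field_simp

/-- **Untwisting at residue degree `f`** (`q_u = q^f`, `b ↦ b^f`): dividing by `(√q_u)^n = (√q)^{fn}`
turns the rank-`2n` polynomial at `q_u` into the powers polynomial `∏_{x root} (X - x^f)`. [folklore] -/
theorem arithFrobPolyOfSatake_pow_map_mul_inv_sqrt_pow (ι : PadicAlgCl ℓ ≃+* ℂ) {q : ℕ} (hq : 0 < q)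
    (n f : ℕ) (B : Multiset ℂ) :
    arithFrobPolyOfSatake ι (q ^ f) (2 * n)
        (B.map (fun b ↦ b ^ f * (((((Real.sqrt q : ℝ) : ℂ)) ^ f) ^ n)⁻¹)) =
      ((arithFrobPolyOfSatake ι q n B).roots.map (fun x ↦ X - C (x ^ f))).prod := by
  rw [roots_arithFrobPolyOfSatake, Multiset.map_map]
  unfold arithFrobPolyOfSatake
  rw [Multiset.map_map]
  refine congrArg Multiset.prod (Multiset.map_congr rfl fun b _ ↦ ?_)
  simp only [Function.comp_apply]
  rw [← map_pow, inv_pow]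
  congr 3
  have hr := sqrt_cast_ne_zero hq
  rw [sqrt_cast_pow q f, two_mul_sub_one, mul_pow, ← pow_mul, ← pow_mul, ← pow_mul,
    Nat.mul_add, pow_add]
  field_simp
  ring

variable {F₀ F : Type} [Field F₀] [NumberField F₀] [Field F] [NumberField F] [Algebra F₀ F]
variable {K : Type} [Field K] [NumberField K] [Algebra F₀ K]

/-- **The dictionary at an arbitrary place `u ∣ v` of a member `K`** (control-a.e. shape of
`stub_patch`): `B` the induced parameter at `v` of `(α_w c_w)_w` (relation `hB`), `u ∣ v` of residue
degree `f`, `β = B^f · s` (`s = ψ₀(ϖ_u) ≠ 0`), `t = s · (√q_u)^n` (`= ψ₁(ϖ_u)`): the rank-`2n`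
arithmetic-Frobenius polynomial of `β · t⁻¹` at `q_u` is `∏_{x root of hostPoly v} (X - x^{f})`. [folklore] -/
theorem dictionary_powers (ι : PadicAlgCl ℓ ≃+* ℂ) (n : ℕ)
    (α : HeightOneSpectrum (𝓞 F) → Multiset ℂ) (c : HeightOneSpectrum (𝓞 F) → ℂ)
    {v : HeightOneSpectrum (𝓞 F₀)} {B : Multiset ℂ}
    (hB : satakePolynomial B = inducedSatakePolynomial v (fun w ↦ (α w).map (fun a ↦ a * c w)))
    {u : HeightOneSpectrum (𝓞 K)} (huv : u.under (𝓞 F₀) = v) {s t : ℂ} (hs : s ≠ 0)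
    (ht : t = s * (((Real.sqrt (u.residueCard : ℝ) : ℝ) : ℂ)) ^ n) :
    arithFrobPolyOfSatake ι u.residueCard (2 * n)
        (((B.map (· ^ u.asIdeal.inertiaDeg (𝓞 F₀))).map (· * s)).map (fun b ↦ b * t⁻¹)) =
      ((hostPoly ι n α c v).roots.map
        (fun x ↦ X - C (x ^ u.asIdeal.inertiaDeg (𝓞 F₀)))).prod := by
  have hq : u.residueCard = v.residueCard ^ u.asIdeal.inertiaDeg (𝓞 F₀) := by
    rw [← huv]; exact residueCard_eq_pow_inertiaDeg (F := F₀) u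
  have hqv : 0 < v.residueCard := zero_lt_one.trans v.one_lt_residueCard
  have hmap : ((B.map (· ^ u.asIdeal.inertiaDeg (𝓞 F₀))).map (· * s)).map (fun b ↦ b * t⁻¹) =
      B.map (fun b ↦ b ^ u.asIdeal.inertiaDeg (𝓞 F₀) *
        (((((Real.sqrt (v.residueCard : ℝ) : ℝ) : ℂ)) ^ u.asIdeal.inertiaDeg (𝓞 F₀)) ^ n)⁻¹) := by
    rw [Multiset.map_map, Multiset.map_map]
    refine Multiset.map_congr rfl fun b _ ↦ ?_
    simp only [Function.comp_apply]
    rw [ht, hq, sqrt_cast_pow, mul_assoc]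
    congr 1
    field_simp
  rw [hmap, hq, arithFrobPolyOfSatake_pow_map_mul_inv_sqrt_pow ι hqv,
    hostPoly_eq_arithFrobPolyOfSatake ι n α c v B hB]

/-- **The dictionary at a place of residue degree one** (coverage shape): with the data of
`dictionary_powers` and `f(u∣v) = 1`, the polynomial of `β · t⁻¹` IS `hostPoly v`. [folklore] -/
theorem dictionary_split (ι : PadicAlgCl ℓ ≃+* ℂ) (n : ℕ)
    (α : HeightOneSpectrum (𝓞 F) → Multiset ℂ) (c : HeightOneSpectrum (𝓞 F) → ℂ)
    {v : HeightOneSpectrum (𝓞 F₀)} {B : Multiset ℂ}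
    (hB : satakePolynomial B = inducedSatakePolynomial v (fun w ↦ (α w).map (fun a ↦ a * c w)))
    {u : HeightOneSpectrum (𝓞 K)} (huv : u.under (𝓞 F₀) = v) (hf : u.asIdeal.inertiaDeg (𝓞 F₀) = 1)
    {s t : ℂ} (hs : s ≠ 0) (ht : t = s * (((Real.sqrt (u.residueCard : ℝ) : ℝ) : ℂ)) ^ n) :
    arithFrobPolyOfSatake ι u.residueCard (2 * n) ((B.map (· * s)).map (fun b ↦ b * t⁻¹)) =
      hostPoly ι n α c v := by
  have hq : u.residueCard = v.residueCard := by
    rw [residueCard_eq_pow_inertiaDeg (F := F₀) u, huv, hf, pow_one]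
  have hqv : 0 < v.residueCard := zero_lt_one.trans v.one_lt_residueCard
  have hmap : (B.map (· * s)).map (fun b ↦ b * t⁻¹) =
      B.map (· * ((((Real.sqrt (v.residueCard : ℝ) : ℝ) : ℂ)) ^ n)⁻¹) := by
    rw [Multiset.map_map]
    refine Multiset.map_congr rfl fun b _ ↦ ?_
    simp only [Function.comp_apply]
    rw [ht, hq, mul_assoc]
    congr 1
    field_simp
  rw [hmap, hq, arithFrobPolyOfSatake_map_mul_inv_sqrt_pow ι hqv,
    hostPoly_eq_arithFrobPolyOfSatake ι n α c v B hB]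

end Dictionary

/-! ## §3 Twisting by an ARBITRARY Hecke character at a place where it is unramified
(the coverage clause reads the dictionary at ONE prescribed place, so the tree's a.e. twist formula and
its finite-order placewise form `heckeCharacter_exists_level_not_dvd_of_isUnramifiedAt` do not suffice) -/

section TwistPlacewise

open scoped MatrixGroups Topology Classical

variable {n : ℕ} {K : Type} [Field K] [NumberField K]

/-- The determinant of a matrix over `K_v` with integral entries is integral. [folklore] -/
private theorem valued_det_le_one_aux' (v : HeightOneSpectrum (𝓞 K))
    {M : Matrix (Fin n) (Fin n) (v.adicCompletion K)} (h : ∀ i j, Valued.v (M i j) ≤ 1) :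
    Valued.v M.det ≤ 1 := by
  -- adapted from Theorems/QuadraticWindowHostInducedRepInducedPackageAux.lean (private there)
  let M₀ : Matrix (Fin n) (Fin n) (v.adicCompletionIntegers K) :=
    Matrix.of fun i j ↦ ⟨M i j, (HeightOneSpectrum.mem_adicCompletionIntegers (R := 𝓞 K) K v).mpr (h i j)⟩
  have hM : M = (v.adicCompletionIntegers K).subtype.mapMatrix M₀ := by
    ext i j; rfl
  rw [hM, ← RingHom.map_det]
  exact (HeightOneSpectrum.mem_adicCompletionIntegers (R := 𝓞 K) K v).mp (M₀.det).2

/-- The determinant of an element of `GL_n(𝒪_v)` is a local unit: `|det g|_v = 1`. [folklore] -/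
private theorem valued_det_eq_one_aux' (v : HeightOneSpectrum (𝓞 K))
    {g : GL (Fin n) (v.adicCompletion K)}
    (hg : g ∈ valuedCongruenceSubgroup (Fin n) (1 : WithZero (Multiplicative ℤ))) :
    Valued.v ((Matrix.GeneralLinearGroup.det g : (v.adicCompletion K)ˣ) : v.adicCompletion K) = 1 := by
  -- adapted from Theorems/QuadraticWindowHostInducedRepInducedPackageAux.lean (private there)
  obtain ⟨h₁, h₂, -⟩ := hg
  have hd : Valued.v ((g : Matrix (Fin n) (Fin n) (v.adicCompletion K)).det) ≤ 1 :=
    valued_det_le_one_aux' v h₁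
  have hd' : Valued.v (((g⁻¹ : GL (Fin n) (v.adicCompletion K)) :
      Matrix (Fin n) (Fin n) (v.adicCompletion K)).det) ≤ 1 := valued_det_le_one_aux' v h₂
  have hprod : (g : Matrix (Fin n) (Fin n) (v.adicCompletion K)).det *
      ((g⁻¹ : GL (Fin n) (v.adicCompletion K)) : Matrix (Fin n) (Fin n) (v.adicCompletion K)).det = 1 := by
    rw [← Matrix.det_mul, ← Units.val_mul, mul_inv_cancel, Units.val_one, Matrix.det_one]
  refine le_antisymm hd ?_
  calc (1 : WithZero (Multiplicative ℤ))
      = Valued.v ((g : Matrix (Fin n) (Fin n) (v.adicCompletion K)).det) *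
          Valued.v (((g⁻¹ : GL (Fin n) (v.adicCompletion K)) :
            Matrix (Fin n) (Fin n) (v.adicCompletion K)).det) := by rw [← map_mul, hprod, map_one]
    _ ≤ Valued.v ((g : Matrix (Fin n) (Fin n) (v.adicCompletion K)).det) * 1 :=
          mul_le_mul' le_rfl hd'
    _ = _ := by rw [mul_one]; rfl

/-- **Every Hecke character has a level prime to any place at which it is unramified**: for `χ`
(any Hecke character of `K`) unramified at `v` and every `n` there is `𝔪 ≠ 0`, `v ∤ 𝔪`, with
`χ (det k) = 1` on `K(𝔪) ≤ GL_n(𝔸_K)`.  Proof: the finite part `K_f(𝔪₀)` of a level `𝔪₀` of `χ ∘ det`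
(`HeckeCharacter.exists_level`) is open, so `exists_principalCongruenceLevel_not_dvd_mul_ofLocal_inv_mem`
gives `𝔪` prime to `v` with `k ι_v(k_v)⁻¹ ∈ K(𝔪₀)` for `k ∈ K(𝔪)` (an element of `K^max` is its own
finite part), and `χ(det ι_v(k_v)) = χ_v(det k_v) = 1` (`det k_v ∈ 𝒪_v^×`, `χ` unramified at `v`).
(Borel–Jacquet 1979, §4.6; Bump §3.3.) [folklore] -/
theorem heckeCharacter_exists_level_not_dvd (n : ℕ) (χ : HeckeCharacter K)
    {v : HeightOneSpectrum (𝓞 K)} (hv : χ.IsUnramifiedAt v) :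
    ∃ 𝔪 : Ideal (𝓞 K), 𝔪 ≠ 0 ∧ ¬ v.asIdeal ∣ 𝔪 ∧
      ∀ k ∈ principalCongruenceLevel n K 𝔪, χ (Matrix.GeneralLinearGroup.det k) = 1 := by
  obtain ⟨𝔪₀, h𝔪₀, hχ𝔪₀⟩ := HeckeCharacter.exists_level n χ
  set U : Set (GL (Fin n) (AdeleRing (𝓞 K) K)) := GLn.sndHom n K ⁻¹'
    (((principalCongruenceLevel n K 𝔪₀).comap (GLn.ofFinite n K) :
      Subgroup (GL (Fin n) (FiniteAdeleRing (𝓞 K) K))) : Set (GL (Fin n) (FiniteAdeleRing (𝓞 K) K)))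
    with hUdef
  have hU : U ∈ 𝓝 (1 : GL (Fin n) (AdeleRing (𝓞 K) K)) := by
    refine ((isOpen_comap_ofFinite_principalCongruenceLevel n K h𝔪₀).preimage
      (GLn.continuous_sndHom (n := n) (K := K))).mem_nhds ?_
    simp only [Set.mem_preimage, map_one, SetLike.mem_coe]
    exact Subgroup.one_mem _
  obtain ⟨𝔪, h𝔪, hv𝔪, hk⟩ := exists_principalCongruenceLevel_not_dvd_mul_ofLocal_inv_mem n K v hU
  refine ⟨𝔪, h𝔪, hv𝔪, fun k hkm ↦ ?_⟩
  have hkint : k ∈ glIntegralLevel n K := principalCongruenceLevel_le n K 𝔪 hkm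
  have hkv : (AdelicGroupData.gl n K).toLocal v k ∈
      valuedCongruenceSubgroup (Fin n) (1 : WithZero (Multiplicative ℤ)) :=
    toLocal_mem_valuedCongruenceSubgroup_one hkint v
  have hs : GLn.ofLocal n K v ((AdelicGroupData.gl n K).toLocal v k) ∈ principalCongruenceLevel n K 𝔪 :=
    isMaximalAt_principalCongruenceLevel n K v h𝔪 hv𝔪 ⟨_, hkv, rfl⟩
  -- the element `g = k ι_v(k_v)⁻¹` of `U`
  have hgU := hk k hkm
  have hgint : k * (GLn.ofLocal n K v ((AdelicGroupData.gl n K).toLocal v k))⁻¹ ∈ glIntegralLevel n K :=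
    (glIntegralLevel n K).mul_mem hkint
      ((glIntegralLevel n K).inv_mem (principalCongruenceLevel_le n K 𝔪 hs))
  have h1 : χ (Matrix.GeneralLinearGroup.det
      (k * (GLn.ofLocal n K v ((AdelicGroupData.gl n K).toLocal v k))⁻¹)) = 1 := by
    have h := hχ𝔪₀ _ (by simpa only [hUdef, Set.mem_preimage, SetLike.mem_coe, Subgroup.mem_comap] using hgU)
    rwa [GLn.ofFinite_sndHom_of_mem hgint] at h
  -- `χ(det ι_v(k_v)) = 1` by unramifiedness
  set d : (v.adicCompletion K)ˣ := Matrix.GeneralLinearGroup.det ((AdelicGroupData.gl n K).toLocal v k)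
  have hdv : Valued.v (d : v.adicCompletion K) = 1 := valued_det_eq_one_aux' v hkv
  let d₀ : (v.adicCompletionIntegers K)ˣ :=
    ⟨⟨d, (HeightOneSpectrum.mem_adicCompletionIntegers (R := 𝓞 K) K v).mpr hdv.le⟩,
      ⟨((d⁻¹ : (v.adicCompletion K)ˣ) : v.adicCompletion K),
        (HeightOneSpectrum.mem_adicCompletionIntegers (R := 𝓞 K) K v).mpr (by
          rw [Units.val_inv_eq_inv_val, map_inv₀, hdv, inv_one])⟩,
      Subtype.ext d.mul_inv, Subtype.ext d.inv_mul⟩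
  have hd₀ : Units.map ((v.adicCompletionIntegers K).subtype : _ →* _) d₀ = d := Units.ext rfl
  have h2 : χ (localUnits v d) = 1 := by
    have := hv d₀
    rwa [hd₀, HeckeCharacter.localComponent_apply] at this
  rw [map_mul, map_inv, map_mul, map_inv, GLn.det_ofLocal, h2, inv_one, mul_one] at h1
  exact h1

/-- **Satake parameters of a twist `π ⊗ (χ ∘ det)` by an ARBITRARY Hecke character at EVERY place
where `π` and `χ` are unramified**: for the twisted datum `π'` (`π'.W = (χ∘det) · π.W`, `π'.W' = …`, as
produced by `exists_cuspidalAutomorphicRepData_twist_hecke`), `t_{π',v} = χ(ϖ_v) t_{π,v}` (Arthur–Clozel,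
Ch. 3, proof of Thm. 3.1), by `HasSatakeParamAt.map_mulChar_detTwist_hecke_of_isUnramifiedAt` at a
level prime to `v`. [cite: ArthurClozelAMS120, Ch. 3, proof of Thm. 3.1 (p. 172)] -/
theorem hasSatakeParamAt_twist_hecke_placewise {hcpt : isCompact_glFiniteIntegralLevel n K}
    {π π' : AutomorphicRepData (AutomorphyDatum.gl n K hcpt)} (χ : HeckeCharacter K)
    (hW : π'.W = π.W.map (mulChar (detTwist n χ))) (hW' : π'.W' = π.W'.map (mulChar (detTwist n χ)))
    {v : HeightOneSpectrum (𝓞 K)} {α : Multiset ℂ} (h : π.HasSatakeParamAt v α)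
    (hvu : χ.IsUnramifiedAt v) :
    π'.HasSatakeParamAt v (α.map (χ.valueAtUniformizer v * ·)) := by
  obtain ⟨𝔪, h𝔪, hv𝔪, hχ𝔪⟩ := heckeCharacter_exists_level_not_dvd n χ hvu
  exact h.map_mulChar_detTwist_hecke_of_isUnramifiedAt χ h𝔪 hχ𝔪 hv𝔪 hvu hW hW'

end TwistPlacewise

/-! ## §3b Norm shifts: `ψ₁ = ψ₀ · ‖·‖^z` at uniformizers (`ψ₁(ϖ_u) = ψ₀(ϖ_u) q_u^{-z}`) -/

section NormShift

variable {K : Type} [Field K] [NumberField K]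

/-- `(χ ψ)(ϖ_u) = χ(ϖ_u) ψ(ϖ_u)`. [folklore] -/
theorem valueAtUniformizer_mul (χ ψ : HeckeCharacter K) (u : HeightOneSpectrum (𝓞 K)) :
    (χ * ψ).valueAtUniformizer u = χ.valueAtUniformizer u * ψ.valueAtUniformizer u := by
  -- adapted from Literature/NumberTheory/GaloisRepresentations/HeckeLFunctionNonvanishingLineProofs.lean
  simp only [HeckeCharacter.valueAtUniformizer, HeckeCharacter.localComponent_apply,
    HeckeCharacter.mul_apply, Units.val_mul]

/-- **`(ψ₀ ‖·‖^z)(ϖ_u) = ψ₀(ϖ_u) · q_u^{-z}`** (`‖ϖ_u‖ = q_u⁻¹`; Tate's thesis §4.3).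
[cite: TateThesis1967, §4.3] -/
theorem valueAtUniformizer_mul_normPow {ψ₀ ν : HeckeCharacter K} {z : ℂ}
    (hν : ∀ x : ideleGroup K, ((ν x : ℂˣ) : ℂ) = ((ideleNorm x : ℝ) : ℂ) ^ z)
    (u : HeightOneSpectrum (𝓞 K)) :
    (ψ₀ * ν).valueAtUniformizer u = ψ₀.valueAtUniformizer u * (u.residueCard : ℂ) ^ (-z) := by
  rw [valueAtUniformizer_mul, HeckeCharacter.valueAtUniformizer_of_forall_apply_eq_cpow hν]
  rfl

/-- A norm shift does not change ramification: `ψ₀ ‖·‖^z` is unramified at `u` iff `ψ₀` is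
(`‖·‖^z` is unramified everywhere, `IsNormTwist.isUnramifiedAt_holds`). [folklore] -/
theorem isUnramifiedAt_mul_normPow_iff {ψ₀ ν : HeckeCharacter K} {z : ℂ}
    (hν : ∀ x : ideleGroup K, ((ν x : ℂˣ) : ℂ) = ((ideleNorm x : ℝ) : ℂ) ^ z)
    (u : HeightOneSpectrum (𝓞 K)) : (ψ₀ * ν).IsUnramifiedAt u ↔ ψ₀.IsUnramifiedAt u := by
  have hνu : ν.IsUnramifiedAt u := HeckeCharacter.IsNormTwist.isUnramifiedAt_holds ⟨z, hν⟩ u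
  refine ⟨fun h x ↦ ?_, fun h x ↦ ?_⟩ <;> have h1 := h x <;> have h2 := hνu x <;>
    rw [HeckeCharacter.localComponent_apply] at h1 h2 ⊢
  · rwa [HeckeCharacter.mul_apply, h2, mul_one] at h1
  · rw [HeckeCharacter.mul_apply, h1, h2, mul_one]

/-- `q^{n/2} = (√q)^n` in `ℂ` (the exponent bookkeeping `ψ₁ = ψ₀ ‖·‖^{-n/2}`:
`ψ₁(ϖ_u) = ψ₀(ϖ_u) (√q_u)^n`, the hypothesis `ht` of `dictionary_powers/_split`). [folklore] -/
theorem natCast_cpow_half (q n : ℕ) : (q : ℂ) ^ ((n : ℂ) / 2) = (((Real.sqrt q : ℝ) : ℂ)) ^ n := by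
  have h : (((Real.sqrt q : ℝ) : ℂ)) ^ n = ((q : ℝ) : ℂ) ^ ((((1 : ℝ) / 2 * n : ℝ)) : ℂ) := by
    rw [← Complex.ofReal_pow, Real.sqrt_eq_rpow, ← Real.rpow_mul_natCast (Nat.cast_nonneg q),
      Complex.ofReal_cpow (Nat.cast_nonneg q)]
  rw [h, Complex.ofReal_natCast]
  congr 1
  push_cast
  ring

/-- **The value of `ψ₁ = ψ₀ ‖·‖^{-n/2}` at a uniformizer**: `ψ₁(ϖ_u) = ψ₀(ϖ_u) · (√q_u)^n`.
[cite: TateThesis1967, §4.3] -/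
theorem valueAtUniformizer_mul_normPow_neg_half {ψ₀ ν : HeckeCharacter K} {n : ℕ}
    (hν : ∀ x : ideleGroup K, ((ν x : ℂˣ) : ℂ) = ((ideleNorm x : ℝ) : ℂ) ^ (-(n : ℂ) / 2))
    (u : HeightOneSpectrum (𝓞 K)) :
    (ψ₀ * ν).valueAtUniformizer u =
      ψ₀.valueAtUniformizer u * (((Real.sqrt (u.residueCard : ℝ) : ℝ) : ℂ)) ^ n := by
  rw [valueAtUniformizer_mul_normPow hν, ← natCast_cpow_half]
  congr 2
  ring

end NormShift

/-! ## §3c The member dictionary lemma -/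

section MemberDict

variable {F₀ F K : Type} [Field F₀] [NumberField F₀] [Field F] [NumberField F] [Algebra F₀ F]
  [Field K] [NumberField K] [Algebra F₀ K]
variable {ℓ : ℕ} [Fact ℓ.Prime]

/-- **The dictionary at one place of a member.**  `PInd` on `GL_{2n}/F₀` with Satake parameter `B` at
`v` inducing the twisted family (`IsInducedPackage` relation), `PiK` a PLACEWISE base change of `PInd`
to `K`, `τ'` the twist of `PiK` by a Hecke character `ψ₀` unramified at the place `u ∣ v` (`v`
unramified in `K`), `ψ₁ = ψ₀ ‖·‖^{-n/2}`: then `ψ₁` is unramified at `u` and `τ'` has a Satake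
parameter `β` at `u` with `arithFrobPolyOfSatake ι q_u (2n) (β ψ₁(ϖ_u)⁻¹) = ∏_{x root of hostPoly v} (X - x^{f(u∣v)})`. -/
theorem member_dictionary (ι : PadicAlgCl ℓ ≃+* ℂ) (n : ℕ)
    {hF₀ : isCompact_glFiniteIntegralLevel (2 * n) F₀} {hK : isCompact_glFiniteIntegralLevel (2 * n) K}
    (PInd : AutomorphicRepData (AutomorphyDatum.gl (2 * n) F₀ hF₀))
    (PiK τ' : AutomorphicRepData (AutomorphyDatum.gl (2 * n) K hK)) (ψ₀ ν : HeckeCharacter K)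
    (hν : ∀ x : ideleGroup K, ((ν x : ℂˣ) : ℂ) = ((ideleNorm x : ℝ) : ℂ) ^ (-(n : ℂ) / 2))
    (hW : τ'.W = PiK.W.map (mulChar (detTwist (2 * n) ψ₀)))
    (hW' : τ'.W' = PiK.W'.map (mulChar (detTwist (2 * n) ψ₀)))
    (hBC : ∀ (u : HeightOneSpectrum (𝓞 K)) (v : HeightOneSpectrum (𝓞 F₀)) (B : Multiset ℂ),
      u.asIdeal.under (𝓞 F₀) = v.asIdeal → Algebra.IsUnramifiedIn (𝓞 K) v.asIdeal →
        PInd.HasSatakeParamAt v B → PiK.HasSatakeParamAt u (B.map (· ^ u.asIdeal.inertiaDeg (𝓞 F₀))))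
    {u : HeightOneSpectrum (𝓞 K)} {v : HeightOneSpectrum (𝓞 F₀)} (huv : u.under (𝓞 F₀) = v)
    (hvK : Algebra.IsUnramifiedIn (𝓞 K) v.asIdeal)
    {α : HeightOneSpectrum (𝓞 F) → Multiset ℂ} {c : HeightOneSpectrum (𝓞 F) → ℂ} {B : Multiset ℂ}
    (hPInd : PInd.HasSatakeParamAt v B)
    (hB : satakePolynomial B = inducedSatakePolynomial v (fun w ↦ (α w).map (fun a ↦ a * c w)))
    (hψu : ψ₀.IsUnramifiedAt u) :
    (ψ₀ * ν).IsUnramifiedAt u ∧ ∃ β : Multiset ℂ, τ'.HasSatakeParamAt u β ∧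
      arithFrobPolyOfSatake ι u.residueCard (2 * n)
          (β.map (fun b ↦ b * ((ψ₀ * ν).valueAtUniformizer u)⁻¹)) =
        ((hostPoly ι n α c v).roots.map (fun x ↦ X - C (x ^ u.asIdeal.inertiaDeg (𝓞 F₀)))).prod := by
  refine ⟨(isUnramifiedAt_mul_normPow_iff hν u).mpr hψu, ?_⟩
  have hPiK := hBC u v B ((place_under_eq_iff_asIdeal u v).mp huv) hvK hPInd
  have hβ := hasSatakeParamAt_twist_hecke_placewise ψ₀ hW hW' hPiK hψu
  refine ⟨_, hβ, ?_⟩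
  have hs : ψ₀.valueAtUniformizer u ≠ 0 := Units.ne_zero _
  have ht := valueAtUniformizer_mul_normPow_neg_half (ψ₀ := ψ₀) hν u
  rw [show (B.map (· ^ u.asIdeal.inertiaDeg (𝓞 F₀))).map (ψ₀.valueAtUniformizer u * ·) =
      (B.map (· ^ u.asIdeal.inertiaDeg (𝓞 F₀))).map (· * ψ₀.valueAtUniformizer u) from
    Multiset.map_congr rfl fun b _ ↦ mul_comm _ _]
  exact dictionary_powers ι n α c hB huv hs ht

/-- The same at a place of residue degree one: `… = hostPoly v` (coverage shape). -/
theorem member_dictionary_split (ι : PadicAlgCl ℓ ≃+* ℂ) (n : ℕ)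
    {hF₀ : isCompact_glFiniteIntegralLevel (2 * n) F₀} {hK : isCompact_glFiniteIntegralLevel (2 * n) K}
    (PInd : AutomorphicRepData (AutomorphyDatum.gl (2 * n) F₀ hF₀))
    (PiK τ' : AutomorphicRepData (AutomorphyDatum.gl (2 * n) K hK)) (ψ₀ ν : HeckeCharacter K)
    (hν : ∀ x : ideleGroup K, ((ν x : ℂˣ) : ℂ) = ((ideleNorm x : ℝ) : ℂ) ^ (-(n : ℂ) / 2))
    (hW : τ'.W = PiK.W.map (mulChar (detTwist (2 * n) ψ₀)))
    (hW' : τ'.W' = PiK.W'.map (mulChar (detTwist (2 * n) ψ₀)))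
    (hBC : ∀ (u : HeightOneSpectrum (𝓞 K)) (v : HeightOneSpectrum (𝓞 F₀)) (B : Multiset ℂ),
      u.asIdeal.under (𝓞 F₀) = v.asIdeal → Algebra.IsUnramifiedIn (𝓞 K) v.asIdeal →
        PInd.HasSatakeParamAt v B → PiK.HasSatakeParamAt u (B.map (· ^ u.asIdeal.inertiaDeg (𝓞 F₀))))
    {u : HeightOneSpectrum (𝓞 K)} {v : HeightOneSpectrum (𝓞 F₀)} (huv : u.under (𝓞 F₀) = v)
    (hvK : Algebra.IsUnramifiedIn (𝓞 K) v.asIdeal) (hf : u.asIdeal.inertiaDeg (𝓞 F₀) = 1)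
    {α : HeightOneSpectrum (𝓞 F) → Multiset ℂ} {c : HeightOneSpectrum (𝓞 F) → ℂ} {B : Multiset ℂ}
    (hPInd : PInd.HasSatakeParamAt v B)
    (hB : satakePolynomial B = inducedSatakePolynomial v (fun w ↦ (α w).map (fun a ↦ a * c w)))
    (hψu : ψ₀.IsUnramifiedAt u) :
    (ψ₀ * ν).IsUnramifiedAt u ∧ ∃ β : Multiset ℂ, τ'.HasSatakeParamAt u β ∧
      arithFrobPolyOfSatake ι u.residueCard (2 * n)
          (β.map (fun b ↦ b * ((ψ₀ * ν).valueAtUniformizer u)⁻¹)) = hostPoly ι n α c v := by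
  obtain ⟨h1, β, hβ, heq⟩ := member_dictionary ι n PInd PiK τ' ψ₀ ν hν hW hW' hBC huv hvK hPInd hB hψu
  refine ⟨h1, β, hβ, ?_⟩
  rw [heq, hf]
  simp only [pow_one]
  have hmon : (hostPoly ι n α c v).Monic := by
    rw [hostPoly_eq_arithFrobPolyOfSatake ι n α c v B hB]
    unfold arithFrobPolyOfSatake
    exact monic_multiset_prod_of_monic _ _ fun a _ ↦ monic_X_sub_C _
  exact prod_multiset_X_sub_C_of_monic_of_roots_card_eq hmon IsAlgClosed.card_roots_eq_natDegree

end MemberDict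

/-- **Registered anchor** of this helper file (stub registry, package helper "Dict"). [folklore] -/
theorem packageDict_anchor : ∀ (q n : ℕ), (q : ℂ) ^ ((n : ℂ) / 2) = (((Real.sqrt q : ℝ) : ℂ)) ^ n :=
  natCast_cpow_half

end Summit.Langlands.Langlands.Theorems.HostInducedRep.OneTransparentPane

end
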